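import Literature.Probability.LatticeModels.NoPlusPercolation
import Literature.Probability.LatticeModels.InfiniteClusterTail
import Literature.Probability.LatticeModels.IsingGibbsMixture
import Literature.Probability.LatticeModels.CriticalTwoPointLower
import HarnessLib

/-!
# Tail-trivial zero-field Ising Gibbs measures: pure phase or two-sided percolation

Topic `Probability/LatticeModels`; theorems only. Consequences of Georgii–Higuchi 2000, Lemma 2.1
(`NoPlusPercolation`), of the tail measurability of `E^±` (`InfiniteClusterTail`) and of the
extremality of `μ^±` (tree: `IsingGibbsMixture.eq_smul_of_dlr_of_le_plus/minus`), for the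
nearest-neighbour Ising model on `ℤ^d`:

* `isTailTrivial_of_spinCorr_eq_plusCorr` / `…_minusCorr` — **`μ⁺` and `μ⁻` are tail trivial**
  (Georgii–Higuchi 2000, §2, p. 3: "the resulting extremality of `μ⁺` and `μ⁻`" with "the
  characterization of extremal Gibbs measures by their triviality on the tail σ-algebra").
* `spinCorr_dichotomy_of_isTailTrivial` — **a tail-trivial `μ ∈ 𝒢(β, 0)` is the minus state, or
  the plus state, or has almost surely both an infinite `+`cluster and an infinite `-`cluster**
  (Lemma 2.1 and its flip, with `μ(E^±) ∈ {0, 1}`). The Aizenman–Higuchi theorem on `ℤ²` is thus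
  reduced (`AizenmanHiguchiReduction`) to excluding `+`/`-` coexistence for tail-trivial Gibbs
  measures at `β > β_c(2)` — the content of Georgii–Higuchi 2000, §§3–5.
* `measure_existsInfCluster_one_eq_one_of_spinCorr_eq_plusCorr` — for `d ≥ 2` and `β > β_c(d)`,
  `μ⁺(E⁺) = 1` (Georgii–Higuchi 2000, p. 8: "`μ⁺(E⁺) = 1` by Lemma 2.1 and tail triviality").

## References

* H.-O. Georgii, Y. Higuchi, J. Math. Phys. 41 (2000) 1153–1169, §2 p. 3, Lemma 2.1, p. 8
  [GeorgiiHiguchi2000].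
-/

noncomputable section

open MeasureTheory
open scoped ENNReal

namespace Literature.Probability.LatticeModels

variable {d : ℕ} {β h : ℝ}

/-! ### The pure phases are tail trivial -/

/-- **The plus state is tail trivial** (Georgii–Higuchi 2000, §2, p. 3: extremality of `μ⁺`;
Georgii 2011, Thm. 7.7): for `β ≥ 0`, any `h` and `μ⁺ ∈ 𝒢(β, h)` with the plus correlations, every
tail event has `μ⁺`-probability `0` or `1`. Proof: for a tail event `B`, the restriction
`μ⁺|_B` satisfies the DLR equations (`IsGibbsMeasure.restrict_bind_spec`) and is dominated by
`μ⁺`, hence equals `μ⁺(B) μ⁺` (`eq_smul_of_dlr_of_le_plus`); evaluating at `Bᶜ` gives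
`μ⁺(B) μ⁺(Bᶜ) = 0`. [cite: GeorgiiHiguchi2000, §2 p. 3] -/
theorem isTailTrivial_of_spinCorr_eq_plusCorr (hβ : 0 ≤ β) {μp : Measure (SpinConfig (Site d))}
    (hμp : μp ∈ isingGibbsMeasures d β h) (hp : ∀ A : Finset (Site d), spinCorr μp A = plusCorr d β h A) :
    IsTailTrivial μp := by
  have hγ : IsSpecification (isingSpecification (zdGraph d) β h) :=
    isSpecification_isingSpecification_zd_holds d β h
  have hμpG : IsGibbsMeasure (isingSpecification (zdGraph d) β h) μp := hμp
  haveI := hμpG.isProbabilityMeasure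
  intro B hB
  have hBm : MeasurableSet B := MeasurableSet.of_tailEvents hB
  have hκ : ∀ (Λ : Finset (Site d)) (A : Set (SpinConfig (Site d))), MeasurableSet A →
      ∫⁻ η, isingSpecification (zdGraph d) β h Λ η A ∂(μp.restrict B) = (μp.restrict B) A := by
    intro Λ A hA
    rw [← Measure.bind_apply hA (hγ.measurable_fun Λ).aemeasurable,
      hμpG.restrict_bind_spec hγ Λ (tailEvents_le_cylinderEvents Λ _ hB)]
  have key := eq_smul_of_dlr_of_le_plus hβ h hμpG hp hκ Measure.restrict_le_self
  have h0 : (μp.restrict B) Bᶜ = (μp.restrict B) Set.univ * μp Bᶜ := by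
    conv_lhs => rw [key]
    rw [Measure.smul_apply, smul_eq_mul]
  rw [Measure.restrict_apply hBm.compl, Set.compl_inter_self, measure_empty,
    Measure.restrict_apply MeasurableSet.univ, Set.univ_inter] at h0
  rcases mul_eq_zero.1 h0.symm with h1 | h1
  · exact Or.inl h1
  · exact Or.inr ((prob_compl_eq_zero_iff hBm).1 h1)

/-- **The minus state is tail trivial** (Georgii–Higuchi 2000, §2, p. 3; Georgii 2011, Thm. 7.7),
by the same argument with `eq_smul_of_dlr_of_le_minus`. [cite: GeorgiiHiguchi2000, §2 p. 3] -/
theorem isTailTrivial_of_spinCorr_eq_minusCorr (hβ : 0 ≤ β) {μm : Measure (SpinConfig (Site d))}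
    (hμm : μm ∈ isingGibbsMeasures d β h) (hm : ∀ A : Finset (Site d), spinCorr μm A = minusCorr d β h A) :
    IsTailTrivial μm := by
  have hγ : IsSpecification (isingSpecification (zdGraph d) β h) :=
    isSpecification_isingSpecification_zd_holds d β h
  have hμmG : IsGibbsMeasure (isingSpecification (zdGraph d) β h) μm := hμm
  haveI := hμmG.isProbabilityMeasure
  intro B hB
  have hBm : MeasurableSet B := MeasurableSet.of_tailEvents hB
  have hκ : ∀ (Λ : Finset (Site d)) (A : Set (SpinConfig (Site d))), MeasurableSet A →
      ∫⁻ η, isingSpecification (zdGraph d) β h Λ η A ∂(μm.restrict B) = (μm.restrict B) A := by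
    intro Λ A hA
    rw [← Measure.bind_apply hA (hγ.measurable_fun Λ).aemeasurable,
      hμmG.restrict_bind_spec hγ Λ (tailEvents_le_cylinderEvents Λ _ hB)]
  have key := eq_smul_of_dlr_of_le_minus hβ h hμmG hm hκ Measure.restrict_le_self
  have h0 : (μm.restrict B) Bᶜ = (μm.restrict B) Set.univ * μm Bᶜ := by
    conv_lhs => rw [key]
    rw [Measure.smul_apply, smul_eq_mul]
  rw [Measure.restrict_apply hBm.compl, Set.compl_inter_self, measure_empty,
    Measure.restrict_apply MeasurableSet.univ, Set.univ_inter] at h0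
  rcases mul_eq_zero.1 h0.symm with h1 | h1
  · exact Or.inl h1
  · exact Or.inr ((prob_compl_eq_zero_iff hBm).1 h1)

/-! ### The dichotomy for tail-trivial zero-field Gibbs measures -/

/-- **Pure phase or two-sided percolation** (Georgii–Higuchi 2000, Lemma 2.1 and its `±`-flipped
form, with the tail triviality of `E^±`): for `β ≥ 0` and a tail-trivial `μ ∈ 𝒢(β, 0)` on `ℤ^d`,
either `μ` has the correlations of `⟨·⟩⁻_β`, or those of `⟨·⟩⁺_β`, or `μ`-almost surely there
exist both an infinite `+`cluster and an infinite `-`cluster. [cite: GeorgiiHiguchi2000, Lemma 2.1] -/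
theorem spinCorr_dichotomy_of_isTailTrivial (hβ : 0 ≤ β) {μ : Measure (SpinConfig (Site d))}
    (hμ : μ ∈ isingGibbsMeasures d β 0) (hμt : IsTailTrivial μ) :
    (∀ A : Finset (Site d), spinCorr μ A = minusCorr d β 0 A) ∨
      (∀ A : Finset (Site d), spinCorr μ A = plusCorr d β 0 A) ∨
        (μ (existsInfCluster (zdGraph d) 1) = 1 ∧ μ (existsInfCluster (zdGraph d) (-1)) = 1) := by
  rcases hμt.measure_existsInfCluster (G := zdGraph d) 1 with h1 | h1
  · exact Or.inl (spinCorr_eq_minusCorr_of_existsInfCluster_null hβ hμ h1)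
  rcases hμt.measure_existsInfCluster (G := zdGraph d) (-1) with h2 | h2
  · exact Or.inr (Or.inl (spinCorr_eq_plusCorr_of_existsInfCluster_neg_null hβ hμ h2))
  exact Or.inr (Or.inr ⟨h1, h2⟩)

/-! ### In the plus phase above `β_c` the `+` spins percolate -/

/-- Above `β_c(d)` (`d ≥ 2`) the plus and minus states differ on the one-point function:
`⟨σ₀⟩⁺_β = m*(β) > 0 > -m*(β) = ⟨σ₀⟩⁻_β`. [cite: GeorgiiHiguchi2000, §2 p. 3] -/
theorem plusCorr_singleton_ne_minusCorr_singleton (hd : 2 ≤ d) (hβ : criticalBeta d < β) :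
    plusCorr d β 0 {0} ≠ minusCorr d β 0 {0} := by
  have hβ0 : 0 ≤ β := (criticalBeta_nonneg d).trans hβ.le
  have hm : 0 < spontaneousMagnetization d β :=
    spontaneousMagnetization_pos_of_criticalBeta_lt_holds (d := d) hd hβ
  rw [spontaneousMagnetization_eq_plusCorr] at hm
  rw [minusCorr_eq_plusCorr_neg hβ0 0 {0}, neg_zero, Finset.card_singleton, pow_one]
  intro h
  linarith

/-- **`μ⁺(E⁺) = 1` above `β_c`** (Georgii–Higuchi 2000, p. 8: "`μ⁺(E⁺) = 1` by Lemma 2.1 and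
tail triviality"): for `d ≥ 2`, `β > β_c(d)` and `μ⁺ ∈ 𝒢(β, 0)` with the plus correlations,
`μ⁺`-almost surely there is an infinite `+`cluster (the alternative `μ⁺(E⁺) = 0` would make `μ⁺`
the minus state, contradicting `m*(β) > 0`). [cite: GeorgiiHiguchi2000, Cor. 3.3 (proof, p. 8)] -/
theorem measure_existsInfCluster_one_eq_one_of_spinCorr_eq_plusCorr (hd : 2 ≤ d)
    (hβ : criticalBeta d < β) {μp : Measure (SpinConfig (Site d))}
    (hμp : μp ∈ isingGibbsMeasures d β 0) (hp : ∀ A : Finset (Site d), spinCorr μp A = plusCorr d β 0 A) :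
    μp (existsInfCluster (zdGraph d) 1) = 1 := by
  have hβ0 : 0 ≤ β := (criticalBeta_nonneg d).trans hβ.le
  rcases (isTailTrivial_of_spinCorr_eq_plusCorr hβ0 hμp hp).measure_existsInfCluster
    (G := zdGraph d) 1 with h0 | h1
  · have hm := spinCorr_eq_minusCorr_of_existsInfCluster_null hβ0 hμp h0 {0}
    rw [hp {0}] at hm
    exact absurd hm (plusCorr_singleton_ne_minusCorr_singleton hd hβ)
  · exact h1

/-- **`μ⁻(E⁻) = 1` above `β_c`** (Georgii–Higuchi 2000, p. 8, by the `±` symmetry): for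
`d ≥ 2`, `β > β_c(d)` and `μ⁻ ∈ 𝒢(β, 0)` with the minus correlations, `μ⁻`-almost surely there is
an infinite `-`cluster. [cite: GeorgiiHiguchi2000, Cor. 3.3 (proof, p. 8)] -/
theorem measure_existsInfCluster_neg_one_eq_one_of_spinCorr_eq_minusCorr (hd : 2 ≤ d)
    (hβ : criticalBeta d < β) {μm : Measure (SpinConfig (Site d))}
    (hμm : μm ∈ isingGibbsMeasures d β 0) (hm : ∀ A : Finset (Site d), spinCorr μm A = minusCorr d β 0 A) :
    μm (existsInfCluster (zdGraph d) (-1)) = 1 := by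
  have hβ0 : 0 ≤ β := (criticalBeta_nonneg d).trans hβ.le
  rcases (isTailTrivial_of_spinCorr_eq_minusCorr hβ0 hμm hm).measure_existsInfCluster
    (G := zdGraph d) (-1) with h0 | h1
  · have hpl := spinCorr_eq_plusCorr_of_existsInfCluster_neg_null hβ0 hμm h0 {0}
    rw [hm {0}] at hpl
    exact absurd hpl.symm (plusCorr_singleton_ne_minusCorr_singleton hd hβ)
  · exact h1

end Literature.Probability.LatticeModels
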